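import Summits.QuantumFields.YangMills.Theorems.BalabanLadderUVRecord13SepCoPDefs
import Literature.MathematicalPhysics.QuantumFieldTheory.Balaban1983to89.Node00.N23Dossier
import HarnessLib

/-!
# BalabanLadder ∕ UV — kernels for the v1.5 (`Provisos₁₃SepCoP`) Stage-13 UV packages: Track A's rev-20 composition at every `N`, θ ⇒ (D, w),
# the Stage-0 projections (today's body of `BalabanLadder.UV` at `N = 2`), and the T⁴ apex AT the pinned record

OS-ASSEMBLY BOOKKEEPING (cell `ym-fleet`, seat `ym-osasm-p1`, director-ym R136 (iii); `--supports stmt-QuantumFields-19351`).  Pure theorems over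
`Theorems/BalabanLadderUVRecord13SepCoPDefs.lean` (`UVAtParams13SepCoP`, `UVAtRecord13CSepCoP`); 0 `sorry`, 0 `def`, standard axioms; COUNT-NEUTRAL — every
hypothesis is an OPEN item's text used by modus ponens.  The `Provisos₁₃SepCoP` twin of `Theorems/BalabanLadderUVRecord13Sep.lean` (p503162) §1–§3: the same
ten kernels with tokens `Provisos₁₃Sep ↦ Provisos₁₃SepCoP`, `datumOfRecord₁₃Sep ↦ datumOfRecord₁₃SepCoP`, `IsRecordOfRecord₁₃CSep ↦ IsRecordOfRecord₁₃CSepCoP` and the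
record API of `Node00/Record13SepCoP.lean` (v1.5 = FILE 24T p521293: `exists_world_isRecordOfRecord₁₃CSepCoP`, `exists_provisos_of_isRecordOfRecord₁₃CSepCoP`,
`isDatumOfRecord₀_of_isRecordOfRecord₁₃CSepCoP`, `isDatumOfRecord₀_datumOfRecord₁₃SepCoP`, `continuumYM4Torus_datumOfRecord₁₃SepCoP`,
`isPrintedAveraged_of_isRecordOfRecord₁₃CSepCoP`).  NO §4 bridge section: `Node00/Record13SepCoP.lean` issues no map from or to the `Provisos₁₃ ∕ Provisos₁₃Sep`
provisos, data or records (`IsRecordOfRecord₁₃CSepCoP.toCoP`: ONE bridge out, to FILE 23's core record `IsRecordOfRecord₁₃CCoP`, «and NONE from or to the U_old provisos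
`Provisos₁₃ ∕ Provisos₁₃Sep ∕ Provisos₁₃SepMixed` (their `bg` and datum read `UbgOfRecord₁₃`)» — as in v1.4's header (ρ5): a different background
object, proviso sets and data not comparable), so the older stations do not feed this one; they stay as settled context.

* §1 `uvAtParams13SepCoP_of_chain` — the detail route's rev-20 deciding composition (the four item texts under the token map, `2 ↦ N`, copied INLINE so
  that this module imports no Theses file) ⇒ `UVAtParams13SepCoP N`, i.e. the re-keyed `BalabanUVNodes.closes` STOPPED one line before its Stage-0
  projection; `uvAtRecord13CSepCoP_of_recordChain` — the same in (D, w) currency.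
* §2 `uvAtRecord13CSepCoP_of_uvAtParams13SepCoP` (θ ⇒ (D, w), `Node00.exists_world_isRecordOfRecord₁₃CSepCoP`, full window `w.γ = θ.γ`),
  `params_of_uvAtRecord13CSepCoP`, and the Stage-0 projections `stage0_of_uvAtParams13SepCoP` ∕ `stage0_of_uvAtRecord13CSepCoP` whose conclusion is VERBATIM
  today's body of `YMDAG.UVSplit.UVD59 N` ∕ (at `N = 2`) `Summit.QuantumFields.YangMills.Theses.BalabanLadder.UV`
  (`Node00.isDatumOfRecord₀_datumOfRecord₁₃SepCoP`, `rfl`) — a consumer closes those goals by `exact`.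
* §3 the T⁴ apex AT THE PINNED v1.5 RECORD in its three currencies (`Node00.continuumYM4Torus_datumOfRecord₁₃SepCoP`,
  `Node00.isPrintedAveraged_of_isRecordOfRecord₁₃CSepCoP`, `Node00.continuumYM4TorusLaw_of_isDatumOfRecord₀`).

ROUTE-INDEPENDENT BY DESIGN: no `Theses` import, no module in a route's cone.  HONEST FRAMING: knits of a CONDITIONAL chain; the packages are
HYPOTHESES (Track A's four items are open); one finite four-torus programme per family at fixed ε; NOT infinite volume, NOT OS on ℝ⁴, NOT a mass gap,
NOT Clay.
-/

set_option autoImplicit false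

namespace Summit.QuantumFields.YangMills.Cruxes.UV.Record13SepCoP

open Literature.MathematicalPhysics.QuantumFieldTheory.Balaban1983to89
open Literature.MathematicalPhysics.QuantumFieldTheory.Balaban1983to89.T4Continuum
open Literature.MathematicalPhysics.QuantumFieldTheory.Balaban1983to89.T4ContinuumYM4Torus

/-! ## §1 Track A's deciding composition, stopped before the Stage-0 projection -/

section Chain

variable {N : ℕ} [NeZero N]

/-- **THE θ-KEYED STAGE-13 UV PACKAGE FROM THE FOUR ITEM TEXTS** (rev 20 of `route-QuantumFields-BalabanUVNodes` on the v1.5 record, `2 ↦ N`): inhabitation of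
the admissible unity tuples with non-degenerate slots (K0⁵ `Record13SepCoPInhabited`) · (B) + window at some such tuple (K1⁵ `StabilityBAtRecordR13SepCoP`) · END given
(B) + window (K2⁵ `EndpointGivenBR13SepCoP`) · hybrid-NE7 spine given (B) + END (K3⁵ `SpineGivenEndpointR13SepCoP`) ⟹ `UVAtParams13SepCoP N`.  Literally the term of the rev-20
`BalabanUVNodes.closes` (plan kit `D67-REV20/glue20.lean`) minus its last line; at `N = 2` the route items ARE these binders (by unfolding). -/
theorem uvAtParams13SepCoP_of_chain
    (h0 : ∀ F : T4Family, ∃ θ : Node00.Stage13Params F N, θ.Provisos₁₃SepCoP F N ∧ (θ.ZtUnity F N ∧ θ.SlotsNondegenerate₁₃ F N) ∧ θ.Admissible F N)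
    (h1 : ∀ F : T4Family, (∃ θ : Node00.Stage13Params F N, θ.Provisos₁₃SepCoP F N ∧ (θ.ZtUnity F N ∧ θ.SlotsNondegenerate₁₃ F N) ∧ θ.Admissible F N) →
      ∃ (θ : Node00.Stage13Params F N) (h : θ.Provisos₁₃SepCoP F N), (θ.ZtUnity F N ∧ θ.SlotsNondegenerate₁₃ F N) ∧ θ.Admissible F N ∧
        B16.EndStatementBPrinted (Node00.datumOfRecord₁₃SepCoP F N θ h).C ∧ ∃ γ₁ : ℝ, 0 < γ₁ ∧ ∀ γ : ℝ, 0 < γ → γ ≤ γ₁ →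
          ∃ P : B12.RunParams, 1 ≤ P.K ∧ ((Node00.datumOfRecord₁₃SepCoP F N θ h).C P).flow.InInterval γ P.K)
    (h2 : ∀ (F : T4Family) (θ : Node00.Stage13Params F N) (h : θ.Provisos₁₃SepCoP F N), (θ.ZtUnity F N ∧ θ.SlotsNondegenerate₁₃ F N) → θ.Admissible F N →
      B16.EndStatementBPrinted (Node00.datumOfRecord₁₃SepCoP F N θ h).C → (∃ γ₁ : ℝ, 0 < γ₁ ∧ ∀ γ : ℝ, 0 < γ → γ ≤ γ₁ →
        ∃ P : B12.RunParams, 1 ≤ P.K ∧ ((Node00.datumOfRecord₁₃SepCoP F N θ h).C P).flow.InInterval γ P.K) →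
      DagBinding.EndpointExistence (Node00.datumOfRecord₁₃SepCoP F N θ h).C.toB12)
    (h3 : ∀ (F : T4Family) (θ : Node00.Stage13Params F N) (h : θ.Provisos₁₃SepCoP F N), (θ.ZtUnity F N ∧ θ.SlotsNondegenerate₁₃ F N) → θ.Admissible F N →
      B16.EndStatementBPrinted (Node00.datumOfRecord₁₃SepCoP F N θ h).C → DagBinding.EndpointExistence (Node00.datumOfRecord₁₃SepCoP F N θ h).C.toB12 →
      T4ApexHybrid.HybridNE7Under (Node00.datumOfRecord₁₃SepCoP F N θ h) (DagBinding.EndpointExistence (Node00.datumOfRecord₁₃SepCoP F N θ h).C.toB12)) :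
    UVAtParams13SepCoP N := by
  intro F
  obtain ⟨θ, h, hU, hθ, hb, hwin⟩ := h1 F (h0 F)
  have hend : DagBinding.EndpointExistence (Node00.datumOfRecord₁₃SepCoP F N θ h).C.toB12 := h2 F θ h hU hθ hb hwin
  exact ⟨θ, h, hU, hθ, hb, hwin, hend, h3 F θ h hU hθ hb hend⟩

/-- **THE (D, w)-KEYED STAGE-13 UV PACKAGE FROM THE FOUR-CHAIN IN RECORD CURRENCY**: inhabitation of the Stage-13 record class · (B) + window at some
record · END given (B) + window · spine given (B) + END ⟹ `UVAtRecord13CSepCoP N`. -/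
theorem uvAtRecord13CSepCoP_of_recordChain
    (h0 : ∀ F : T4Family, ∃ (D : FiniteEpsData F (Matrix.specialUnitaryGroup (Fin N) ℂ)) (w : DagBinding.WorldP),
      Node00.IsRecordOfRecord₁₃CSepCoP F N D w)
    (h1 : ∀ F : T4Family, (∃ (D : FiniteEpsData F (Matrix.specialUnitaryGroup (Fin N) ℂ)) (w : DagBinding.WorldP),
        Node00.IsRecordOfRecord₁₃CSepCoP F N D w) →
      ∃ (D : FiniteEpsData F (Matrix.specialUnitaryGroup (Fin N) ℂ)) (w : DagBinding.WorldP), Node00.IsRecordOfRecord₁₃CSepCoP F N D w ∧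
        B16.EndStatementBPrinted D.C ∧ ∃ γ₁ : ℝ, 0 < γ₁ ∧ ∀ γ : ℝ, 0 < γ → γ ≤ γ₁ →
          ∃ P : B12.RunParams, 1 ≤ P.K ∧ (D.C P).flow.InInterval γ P.K)
    (h2 : ∀ (F : T4Family) (D : FiniteEpsData F (Matrix.specialUnitaryGroup (Fin N) ℂ)) (w : DagBinding.WorldP),
      Node00.IsRecordOfRecord₁₃CSepCoP F N D w → B16.EndStatementBPrinted D.C → (∃ γ₁ : ℝ, 0 < γ₁ ∧ ∀ γ : ℝ, 0 < γ → γ ≤ γ₁ →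
        ∃ P : B12.RunParams, 1 ≤ P.K ∧ (D.C P).flow.InInterval γ P.K) → DagBinding.EndpointExistence D.C.toB12)
    (h3 : ∀ (F : T4Family) (D : FiniteEpsData F (Matrix.specialUnitaryGroup (Fin N) ℂ)) (w : DagBinding.WorldP),
      Node00.IsRecordOfRecord₁₃CSepCoP F N D w → B16.EndStatementBPrinted D.C → DagBinding.EndpointExistence D.C.toB12 →
        T4ApexHybrid.HybridNE7Under D (DagBinding.EndpointExistence D.C.toB12)) :
    UVAtRecord13CSepCoP N := by
  intro F
  obtain ⟨D, w, hR, hb, hwin⟩ := h1 F (h0 F)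
  have hend : DagBinding.EndpointExistence D.C.toB12 := h2 F D w hR hb hwin
  exact ⟨D, w, hR, hb, hwin, hend, h3 F D w hR hb hend⟩

end Chain

/-! ## §2 The change of currency θ ⇒ (D, w) and the Stage-0 projections (the bodies of `UVD59 N` ∕ `BalabanLadder.UV`) -/

section Projections

variable {N : ℕ} [NeZero N]

/-- **θ ⇒ (D, w)**: the θ-keyed package gives the (D, w)-keyed one — every admissible Stage-13 tuple with provisos IS a Stage-13 record at a world bound to
its construction, with the full window `w.γ = θ.γ` (`Node00.exists_world_isRecordOfRecord₁₃CSepCoP`; `0 < θ.γ` from admissibility); the unity clause is dropped. -/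
theorem uvAtRecord13CSepCoP_of_uvAtParams13SepCoP (h : UVAtParams13SepCoP N) : UVAtRecord13CSepCoP N := by
  intro F
  obtain ⟨θ, hP, -, hθ, hb, hwin, hend, hNE⟩ := h F
  obtain ⟨w, hw, -⟩ := Node00.exists_world_isRecordOfRecord₁₃CSepCoP F N θ hP hθ ⟨hθ.toStage9.gamma_pos, le_rfl⟩
  exact ⟨Node00.datumOfRecord₁₃SepCoP F N θ hP, w, hw, hb, hwin, hend, hNE⟩

/-- **(D, w) ⇒ θ, without unity**: a (D, w)-keyed package reads through Bałaban's parameters — the record predicate certifies admissible θ with provisos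
and `D = datumOfRecord₁₃SepCoP F N θ h` (`Node00.exists_provisos_of_isRecordOfRecord₁₃CSepCoP`); the partition-of-unity ∕ non-degeneracy clause of `UVAtParams13SepCoP` is
NOT recoverable from the record predicate (it is K0⁵'s extra datum), so this is not a converse of `uvAtRecord13CSepCoP_of_uvAtParams13SepCoP`. -/
theorem params_of_uvAtRecord13CSepCoP (h : UVAtRecord13CSepCoP N) (F : T4Family) :
    ∃ (θ : Node00.Stage13Params F N) (hP : θ.Provisos₁₃SepCoP F N), θ.Admissible F N ∧
      B16.EndStatementBPrinted (Node00.datumOfRecord₁₃SepCoP F N θ hP).C ∧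
      (∃ γ₁ : ℝ, 0 < γ₁ ∧ ∀ γ : ℝ, 0 < γ → γ ≤ γ₁ →
        ∃ P : B12.RunParams, 1 ≤ P.K ∧ ((Node00.datumOfRecord₁₃SepCoP F N θ hP).C P).flow.InInterval γ P.K) ∧
      DagBinding.EndpointExistence (Node00.datumOfRecord₁₃SepCoP F N θ hP).C.toB12 ∧
      T4ApexHybrid.HybridNE7Under (Node00.datumOfRecord₁₃SepCoP F N θ hP)
        (DagBinding.EndpointExistence (Node00.datumOfRecord₁₃SepCoP F N θ hP).C.toB12) := by
  obtain ⟨D, w, hR, hb, hwin, hend, hNE⟩ := h F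
  obtain ⟨θ, hP, hθ, rfl⟩ := Node00.exists_provisos_of_isRecordOfRecord₁₃CSepCoP hR
  exact ⟨θ, hP, hθ, hb, hwin, hend, hNE⟩

/-- **THE STAGE-0 PROJECTION OF THE (D, w)-KEYED PACKAGE** — conclusion VERBATIM the body of `YMDAG.UVSplit.UVD59 N` (at `N = 2`: of
`Summit.QuantumFields.YangMills.Theses.BalabanLadder.UV`): on every family a Stage-0 datum of record with (B), END and the spine
(`Node00.isDatumOfRecord₀_of_isRecordOfRecord₁₃CSepCoP`; the window and the world are forgotten).  A consumer closes `UVD59 N` ∕ `BalabanLadder.UV` by `exact`. -/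
theorem stage0_of_uvAtRecord13CSepCoP (h : UVAtRecord13CSepCoP N) (F : T4Family) :
    ∃ D : FiniteEpsData F (Matrix.specialUnitaryGroup (Fin N) ℂ), Node00.IsDatumOfRecord₀ F N D ∧ B16.EndStatementBPrinted D.C ∧
      DagBinding.EndpointExistence D.C.toB12 ∧ T4ApexHybrid.HybridNE7Under D (DagBinding.EndpointExistence D.C.toB12) := by
  obtain ⟨D, w, hR, hb, -, hend, hNE⟩ := h F
  exact ⟨D, Node00.isDatumOfRecord₀_of_isRecordOfRecord₁₃CSepCoP hR, hb, hend, hNE⟩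

/-- **THE STAGE-0 PROJECTION OF THE θ-KEYED PACKAGE** — the last line of the rev-20 `BalabanUVNodes.closes` with `2 ↦ N`
(`Node00.isDatumOfRecord₀_datumOfRecord₁₃SepCoP`, `rfl`); conclusion VERBATIM the body of `YMDAG.UVSplit.UVD59 N` ∕ (at `N = 2`) today's body of `BalabanLadder.UV`.
Under a θ-pinned E1 text of `UV` this is, at `N = 2`, the one-direction tether `UV → UVD59 2`. -/
theorem stage0_of_uvAtParams13SepCoP (h : UVAtParams13SepCoP N) (F : T4Family) :
    ∃ D : FiniteEpsData F (Matrix.specialUnitaryGroup (Fin N) ℂ), Node00.IsDatumOfRecord₀ F N D ∧ B16.EndStatementBPrinted D.C ∧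
      DagBinding.EndpointExistence D.C.toB12 ∧ T4ApexHybrid.HybridNE7Under D (DagBinding.EndpointExistence D.C.toB12) := by
  obtain ⟨θ, hP, -, -, hb, -, hend, hNE⟩ := h F
  exact ⟨Node00.datumOfRecord₁₃SepCoP F N θ hP, Node00.isDatumOfRecord₀_datumOfRecord₁₃SepCoP F N θ hP, hb, hend, hNE⟩

end Projections

/-! ## §3 The T⁴ apex AT THE PINNED RECORD, in its three currencies -/

section Apex

variable {N : ℕ} [NeZero N]

/-- **THE APEX AT THE θ-KEYED RECORD, ∀- and ∃-readings**: on every family an admissible unity tuple θ with provisos whose datum of record has endpoint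
existence AND `ContinuumYM4Torus ∧ ContinuumYM4TorusE` — for all small `γ`, `g` and every (resp. some) tuned bare-coupling sequence the joint expectations of
the unit-scale averaged loop variables converge as `ε → 0`, limit points agree, are reflection positive and torus covariant
(`Node00.continuumYM4Torus_datumOfRecord₁₃SepCoP` + `continuumYM4TorusE_of_endpoint`). -/
theorem apex_of_uvAtParams13SepCoP (h : UVAtParams13SepCoP N) (F : T4Family) :
    ∃ (θ : Node00.Stage13Params F N) (hP : θ.Provisos₁₃SepCoP F N), (θ.ZtUnity F N ∧ θ.SlotsNondegenerate₁₃ F N) ∧ θ.Admissible F N ∧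
      DagBinding.EndpointExistence (Node00.datumOfRecord₁₃SepCoP F N θ hP).C.toB12 ∧
      ContinuumYM4Torus (Node00.datumOfRecord₁₃SepCoP F N θ hP) ∧ ContinuumYM4TorusE (Node00.datumOfRecord₁₃SepCoP F N θ hP) := by
  obtain ⟨θ, hP, hU, hθ, hb, -, hend, hNE⟩ := h F
  have hT : ContinuumYM4Torus (Node00.datumOfRecord₁₃SepCoP F N θ hP) := Node00.continuumYM4Torus_datumOfRecord₁₃SepCoP F N θ hP hb hend hNE
  exact ⟨θ, hP, hU, hθ, hend, hT, continuumYM4TorusE_of_endpoint hend hT⟩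

/-- **THE APEX AT THE θ-KEYED RECORD, LAW-READING**: on every family an admissible unity tuple θ with provisos AT WHOSE datum of record
`ContinuumYM4TorusLaw` holds — for all small `γ`, `g` and every tuned bare-coupling sequence exactly ONE Borel probability law on the loop cube is the
full-sequence weak limit of the laws of the unit-scale averaged loop variables, OS-positive on every strict cone and invariant under the unit-torus
isometries (`Node00.continuumYM4TorusLaw_of_isDatumOfRecord₀`; measurability witness `Node00.avgMeasurable_of_isDatumOfRecord₀`). -/
theorem law_of_uvAtParams13SepCoP (h : UVAtParams13SepCoP N) (F : T4Family) :
    ∃ (θ : Node00.Stage13Params F N) (hP : θ.Provisos₁₃SepCoP F N), (θ.ZtUnity F N ∧ θ.SlotsNondegenerate₁₃ F N) ∧ θ.Admissible F N ∧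
      DagBinding.EndpointExistence (Node00.datumOfRecord₁₃SepCoP F N θ hP).C.toB12 ∧
      ContinuumYM4TorusLaw (Node00.datumOfRecord₁₃SepCoP F N θ hP)
        (Node00.avgMeasurable_of_isDatumOfRecord₀ (Node00.isDatumOfRecord₀_datumOfRecord₁₃SepCoP F N θ hP)) := by
  obtain ⟨θ, hP, hU, hθ, hb, -, hend, hNE⟩ := h F
  exact ⟨θ, hP, hU, hθ, hend,
    Node00.continuumYM4TorusLaw_of_isDatumOfRecord₀ (Node00.isDatumOfRecord₀_datumOfRecord₁₃SepCoP F N θ hP) hb hend hNE⟩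

/-- **THE APEX AT A (D, w)-KEYED RECORD, ∀- and ∃-readings** (`continuumYM4_torus_of_endpointExistence_nonvacuous`, B1 by
`Node00.isPrintedAveraged_of_isRecordOfRecord₁₃CSepCoP`). -/
theorem apex_of_uvAtRecord13CSepCoP (h : UVAtRecord13CSepCoP N) (F : T4Family) :
    ∃ (D : FiniteEpsData F (Matrix.specialUnitaryGroup (Fin N) ℂ)) (w : DagBinding.WorldP), Node00.IsRecordOfRecord₁₃CSepCoP F N D w ∧
      DagBinding.EndpointExistence D.C.toB12 ∧ ContinuumYM4Torus D ∧ ContinuumYM4TorusE D := by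
  obtain ⟨D, w, hR, hb, -, hend, hNE⟩ := h F
  exact ⟨D, w, hR, hend, continuumYM4_torus_of_endpointExistence_nonvacuous D
    (Node00.isPrintedAveraged_of_isRecordOfRecord₁₃CSepCoP hR) hb hend hNE⟩

/-- **THE APEX AT A (D, w)-KEYED RECORD, LAW-READING** (`Node00.continuumYM4TorusLaw_of_isDatumOfRecord₀` at
`Node00.isDatumOfRecord₀_of_isRecordOfRecord₁₃CSepCoP`). -/
theorem law_of_uvAtRecord13CSepCoP (h : UVAtRecord13CSepCoP N) (F : T4Family) :
    ∃ (D : FiniteEpsData F (Matrix.specialUnitaryGroup (Fin N) ℂ)) (w : DagBinding.WorldP) (hR : Node00.IsRecordOfRecord₁₃CSepCoP F N D w),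
      DagBinding.EndpointExistence D.C.toB12 ∧
      ContinuumYM4TorusLaw D (Node00.avgMeasurable_of_isDatumOfRecord₀ (Node00.isDatumOfRecord₀_of_isRecordOfRecord₁₃CSepCoP hR)) := by
  obtain ⟨D, w, hR, hb, -, hend, hNE⟩ := h F
  exact ⟨D, w, hR, hend,
    Node00.continuumYM4TorusLaw_of_isDatumOfRecord₀ (Node00.isDatumOfRecord₀_of_isRecordOfRecord₁₃CSepCoP hR) hb hend hNE⟩

end Apex

end Summit.QuantumFields.YangMills.Cruxes.UV.Record13SepCoP
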